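import Literature.MathematicalPhysics.QuantumLattice.GibbsTwoTimeBound
import Literature.MathematicalPhysics.QuantumLattice.FinDimSpectrumSectorGibbsLimit
import Summits.HubbardSuperconductivity.HubbardSuperconductivity.Theorems.BalabanIRBirEveryGroundStateHeadCount
import HarnessLib

/-!
# Route `BalabanIR`, crux 5 `BirEveryGroundState` (`stmt-HubbardSuperconductivity-2083`):
# the one-vector Peierls–Bogoliubov inequality with an entropy budget (finite dimension)

Core of the ENGINE-FACING closer of crux 5 (companion module
`BalabanIRBirEveryGroundStateThermalChord`, which specialises to the Hubbard torus and closes the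
item's body from a thermal κ-chord). For Hermitian `H`, `A`, an `H`-invariant subspace `K` with
orthogonal projection `P_K` and sector energy `e₀ = minEnergyOn H K`, a normalised SECTOR GROUND
STATE `ψ ∈ K` (`H ψ = e₀ ψ`) and `κ, β > 0`:

* `exp_neg_mul_rayleigh_le_re_gibbsWeight` — spectral Jensen `e^{-β re⟨ψ,Xψ⟩} ≤ re ⟨ψ, e^{-βX} ψ⟩`;
* `re_rayleigh_le_re_trace_projMatrix_mul` — `re ⟨ψ, B ψ⟩ ≤ re tr (P_K B)` for `B ≥ 0`, `ψ ∈ K`;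
* `re_trace_sectorProj_mul_gibbsWeight_le` — the ENTROPY BUDGET `re tr (P_K e^{-βH}) ≤ dim K · e^{-βe₀}`;
* `thermalChord_le_re_rayleigh` — THE INEQUALITY
  `(log re tr (P_K e^{-βH}) - log re tr (P_K e^{-β(H+κA)}) - log dim K) / (βκ) ≤ re ⟨ψ, A ψ⟩`:
  a sector free-energy increment under the penalty `κA`, read at ONE finite `β`, bounds the
  `A`-expectation of EVERY sector ground state from below — whatever the degeneracy of the ground
  eigenspace, with no genericity, irreducibility, gap or `β → ∞` limit.

This module imports NO route file (rev-5 materialisation rule). Sources: B. Simon, *The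
Statistical Mechanics of Lattice Gases* I (1993) §II.13 (Peierls–Bogoliubov, Jensen);
Bratteli–Robinson II §5.3.1; Tasaki (2020) App. A; Bhatia, *Matrix Analysis* §I.2. Folklore; no
definition is introduced.

## Mathlib / tree search

REUSED: `Matrix.gibbsWeight`, `Matrix.posDef_gibbsWeight`, `Matrix.IsHermitian.eq_conj_diagonal`,
`Literature.MathematicalPhysics.QuantumLattice.gibbsWeight_eq_conj_diagonal`,
`trace_gibbsWeight_mul_eq_sum`, `projMatrix_mul_self`, `projMatrix_map_mulVec_of_mem`,
`projMatrix_map_mulVec_eigenvector_below_eq_zero`, `trace_projMatrix_map_eq_finrank`,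
`Theorems.re_star_mulVec_dotProduct_mulVec_le` (Frobenius), `Theorems.re_star_dotProduct_self_eq_sum`;
Mathlib `convexOn_exp.map_sum_le`, `CStarAlgebra.nonneg_iff_eq_star_mul_self`.
-/

noncomputable section

open scoped Matrix.Norms.L2Operator ComplexOrder MatrixOrder InnerProductSpace

namespace Summit.HubbardSuperconductivity.HubbardSuperconductivity.Theorems

open Matrix Finset Filter Literature.MathematicalPhysics.QuantumLattice

/-! ### Finite-dimensional lemmas: one-vector Peierls–Bogoliubov and the entropy budget -/

section Abstract

variable {n : Type*} [Fintype n] [DecidableEq n]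

omit [DecidableEq n] in
/-- `re ⟨ψ, U diag(d) U⋆ ψ⟩ = Σ_k d_k |(U⋆ψ)_k|²` for real `d`. [folklore] -/
theorem re_star_dotProduct_conj_diagonal_mulVec [DecidableEq n] (U : Matrix n n ℂ) (d : n → ℝ)
    (ψ : n → ℂ) :
    (star ψ ⬝ᵥ (U * diagonal (fun i => (d i : ℂ)) * star U) *ᵥ ψ).re =
      ∑ k, d k * ‖(star U *ᵥ ψ) k‖ ^ 2 := by
  set φ : n → ℂ := star U *ᵥ ψ with hφ
  have h1 : (U * diagonal (fun i => (d i : ℂ)) * star U) *ᵥ ψ =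
      U *ᵥ (diagonal (fun i => (d i : ℂ)) *ᵥ φ) := by
    simp only [hφ, ← mulVec_mulVec]
  have h2 : star ψ ᵥ* U = star φ := by
    rw [hφ, star_mulVec, star_eq_conjTranspose, conjTranspose_conjTranspose]
  rw [h1, dotProduct_mulVec, h2, dotProduct, Complex.re_sum]
  refine Finset.sum_congr rfl fun k _ => ?_
  rw [mulVec_diagonal, Pi.star_apply, Complex.star_def,
    show (starRingEnd ℂ) (φ k) * ((d k : ℂ) * φ k) = (d k : ℂ) * ((starRingEnd ℂ) (φ k) * φ k) by
      ring,
    Complex.conj_mul', Complex.re_ofReal_mul]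
  norm_cast

/-- For a unitary `U` and a unit vector `ψ` the weights `|(U⋆ψ)_k|²` sum to `1`. [folklore] -/
theorem sum_norm_sq_star_mulVec_eq_one {U : Matrix n n ℂ} (hU : U ∈ unitary (Matrix n n ℂ))
    {ψ : n → ℂ} (hψ : star ψ ⬝ᵥ ψ = 1) : ∑ k, ‖(star U *ᵥ ψ) k‖ ^ 2 = 1 := by
  have h := re_star_dotProduct_conj_diagonal_mulVec U (fun _ => (1 : ℝ)) ψ
  have h1 : diagonal (fun _ : n => ((1 : ℝ) : ℂ)) = 1 := by simp
  rw [h1, Matrix.mul_one, Unitary.mul_star_self_of_mem hU, one_mulVec, hψ, Complex.one_re] at h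
  simpa using h.symm

/-- **Spectral Jensen (one-vector Peierls inequality).** For a Hermitian `X`, a real `β` and a
unit vector `ψ`: `e^{-β re ⟨ψ, X ψ⟩} ≤ re ⟨ψ, e^{-βX} ψ⟩` (both sides are averages over the
spectral weights `|(U⋆ψ)_k|²` of `ψ`; convexity of `exp`). B. Simon, *Statistical Mechanics of
Lattice Gases* I §II.13; Bratteli–Robinson II §5.3.1. [folklore] -/
theorem exp_neg_mul_rayleigh_le_re_gibbsWeight {X : Matrix n n ℂ} (hX : X.IsHermitian) (β : ℝ)
    {ψ : n → ℂ} (hψ : star ψ ⬝ᵥ ψ = 1) :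
    Real.exp (-(β * (star ψ ⬝ᵥ X *ᵥ ψ).re)) ≤ (star ψ ⬝ᵥ gibbsWeight β X *ᵥ ψ).re := by
  set U : Matrix n n ℂ := (hX.eigenvectorUnitary : Matrix n n ℂ) with hU
  have hUm : U ∈ unitary (Matrix n n ℂ) := hX.eigenvectorUnitary.prop
  set w : n → ℝ := fun k => ‖(star U *ᵥ ψ) k‖ ^ 2 with hw
  have hw0 : ∀ k, 0 ≤ w k := fun k => sq_nonneg _
  have hw1 : ∑ k, w k = 1 := sum_norm_sq_star_mulVec_eq_one hUm hψ
  have hX' : (star ψ ⬝ᵥ X *ᵥ ψ).re = ∑ k, hX.eigenvalues k * w k := by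
    conv_lhs => rw [hX.eq_conj_diagonal, ← hU]
    rw [re_star_dotProduct_conj_diagonal_mulVec]
  have hG : (star ψ ⬝ᵥ gibbsWeight β X *ᵥ ψ).re =
      ∑ k, Real.exp (-β * hX.eigenvalues k) * w k := by
    rw [gibbsWeight_eq_conj_diagonal hX β, ← hU, re_star_dotProduct_conj_diagonal_mulVec]
  rw [hX', hG]
  have hJ := (convexOn_exp).map_sum_le (t := (univ : Finset n)) (w := w)
    (p := fun k => -β * hX.eigenvalues k) (fun k _ => hw0 k) hw1 (fun k _ => Set.mem_univ _)
  simp only [smul_eq_mul] at hJ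
  have hsum : ∑ k, w k * (-β * hX.eigenvalues k) = -(β * ∑ k, hX.eigenvalues k * w k) := by
    rw [mul_sum, ← sum_neg_distrib]
    exact Finset.sum_congr rfl fun k _ => by ring
  rw [hsum] at hJ
  exact hJ.trans (le_of_eq (Finset.sum_congr rfl fun k _ => by ring))

/-- For `C ≥ 0` and a unit vector `ψ`: `re ⟨ψ, C ψ⟩ ≤ re tr C` (write `C = E⋆E` and use the
Frobenius bound `‖E ψ‖² ≤ ‖E‖_F²`). Bhatia, *Matrix Analysis* §I.2. [folklore] -/
theorem re_rayleigh_le_re_trace_of_posSemidef {C : Matrix n n ℂ} (hC : C.PosSemidef)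
    {ψ : n → ℂ} (hψ : star ψ ⬝ᵥ ψ = 1) : (star ψ ⬝ᵥ C *ᵥ ψ).re ≤ C.trace.re := by
  obtain ⟨E, hE⟩ := CStarAlgebra.nonneg_iff_eq_star_mul_self.mp hC.nonneg
  have h := re_star_mulVec_dotProduct_mulVec_le E ψ
  rw [hψ, Complex.one_re, mul_one, star_mulVec, ← dotProduct_mulVec, ← star_eq_conjTranspose]
    at h
  rw [hE, ← mulVec_mulVec]
  exact h

/-- **Compression dominates one vector.** For `B ≥ 0`, a subspace `K` with orthogonal projection
`P_K` and a unit vector `ψ ∈ K`: `re ⟨ψ, B ψ⟩ ≤ re tr (P_K B)` (`= re tr (P_K B P_K)`, and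
`⟨ψ, B ψ⟩ = ⟨ψ, P_K B P_K ψ⟩` is one Rayleigh quotient of the positive matrix `P_K B P_K`).
Tasaki (2020) App. A.2. [folklore] -/
theorem re_rayleigh_le_re_trace_projMatrix_mul {B : Matrix n n ℂ} (hB : B.PosSemidef)
    (K : Submodule ℂ (n → ℂ)) {ψ : n → ℂ} (hψK : ψ ∈ K) (hψ : star ψ ⬝ᵥ ψ = 1) :
    (star ψ ⬝ᵥ B *ᵥ ψ).re ≤
      (projMatrix (K.map ((WithLp.linearEquiv 2 ℂ (n → ℂ)).symm :
        (n → ℂ) →ₗ[ℂ] EuclideanSpace ℂ n)) * B).trace.re := by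
  set P := projMatrix (K.map ((WithLp.linearEquiv 2 ℂ (n → ℂ)).symm :
    (n → ℂ) →ₗ[ℂ] EuclideanSpace ℂ n)) with hP
  have hPH : Pᴴ = P := (projMatrix_isHermitian _).eq
  have hPP : P * P = P := projMatrix_mul_self _
  have hPψ : P *ᵥ ψ = ψ := projMatrix_map_mulVec_of_mem K hψK
  have hψP : star ψ ᵥ* P = star ψ := by
    rw [← hPH, ← star_mulVec, hPψ]
  have hC : (P * B * Pᴴ).PosSemidef := hB.mul_mul_conjTranspose_same P
  have h1 : star ψ ⬝ᵥ (P * B * Pᴴ) *ᵥ ψ = star ψ ⬝ᵥ B *ᵥ ψ := by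
    rw [hPH, ← mulVec_mulVec, ← mulVec_mulVec, hPψ, dotProduct_mulVec, hψP]
  have h2 : (P * B * Pᴴ).trace = (P * B).trace := by
    rw [hPH, trace_mul_cycle, hPP]
  have h := re_rayleigh_le_re_trace_of_posSemidef hC hψ
  rwa [h1, h2] at h

omit [DecidableEq n] in
/-- The diagonal entries of `U⋆ P U` are the Rayleigh quotients of `P` on the columns of `U`.
[folklore] -/
theorem star_mul_mul_apply_self (U P : Matrix n n ℂ) (i : n) :
    (star U * P * U) i i = star (fun k => U k i) ⬝ᵥ P *ᵥ (fun k => U k i) := by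
  simp only [Matrix.mul_apply, mulVec, dotProduct, Pi.star_apply, star_eq_conjTranspose,
    conjTranspose_apply, Finset.sum_mul]
  rw [Finset.sum_comm]
  refine Finset.sum_congr rfl fun j _ => ?_
  rw [Finset.mul_sum]
  exact Finset.sum_congr rfl fun k _ => by ring

/-- **Entropy budget of a sector.** For a Hermitian `H`, an `H`-invariant subspace `K` with
orthogonal projection `P_K` and sector energy `e₀ = minEnergyOn H K`, and `β ≥ 0`:
`re tr (P_K e^{-βH}) ≤ dim K · e^{-β e₀}`. (In an eigenbasis `u_i` of `H`,
`tr (P_K e^{-βH}) = Σ_i e^{-βλ_i} ‖P_K u_i‖²`; the columns with `λ_i < e₀` are annihilated by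
`P_K` (`projMatrix_map_mulVec_eigenvector_below_eq_zero`), the others carry `e^{-βλ_i} ≤ e^{-βe₀}`,
and `Σ_i ‖P_K u_i‖² = tr P_K = dim K`.) Tasaki (2020) App. A; Bratteli–Robinson II §5.3.1.
[folklore] -/
theorem re_trace_sectorProj_mul_gibbsWeight_le {H : Matrix n n ℂ} (hH : H.IsHermitian)
    (K : Submodule ℂ (n → ℂ)) (hinv : ∀ v ∈ K, H *ᵥ v ∈ K) {β : ℝ} (hβ : 0 ≤ β) :
    (projMatrix (K.map ((WithLp.linearEquiv 2 ℂ (n → ℂ)).symm :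
        (n → ℂ) →ₗ[ℂ] EuclideanSpace ℂ n)) * gibbsWeight β H).trace.re ≤
      (Module.finrank ℂ K : ℝ) * Real.exp (-(β * H.minEnergyOn K)) := by
  set P := projMatrix (K.map ((WithLp.linearEquiv 2 ℂ (n → ℂ)).symm :
    (n → ℂ) →ₗ[ℂ] EuclideanSpace ℂ n)) with hP
  set e₀ : ℝ := H.minEnergyOn K with he₀
  set U : Matrix n n ℂ := (hH.eigenvectorUnitary : Matrix n n ℂ) with hU
  have hUm : U ∈ unitary (Matrix n n ℂ) := hH.eigenvectorUnitary.prop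
  have hPH : Pᴴ = P := (projMatrix_isHermitian _).eq
  have hPP : P * P = P := projMatrix_mul_self _
  have hcol : ∀ j, H *ᵥ (fun i => U i j) = ((hH.eigenvalues j : ℝ) : ℂ) • (fun i => U i j) := by
    intro j
    have h : (fun i => U i j) = ⇑(hH.eigenvectorBasis j) :=
      funext fun i => IsHermitian.eigenvectorUnitary_apply hH i j
    rw [h, hH.mulVec_eigenvectorBasis j, RCLike.real_smul_eq_coe_smul (K := ℂ)]
    rfl
  set c : n → ℂ := fun i => (star U * P * U) i i with hc
  have hc_eq : ∀ i, c i = star (P *ᵥ fun k => U k i) ⬝ᵥ (P *ᵥ fun k => U k i) := by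
    intro i
    show (star U * P * U) i i = _
    rw [star_mul_mul_apply_self, star_mulVec, ← dotProduct_mulVec, hPH, mulVec_mulVec, hPP]
  have hc_re : ∀ i, 0 ≤ (c i).re := by
    intro i
    rw [hc_eq, re_star_dotProduct_self_eq_sum]
    positivity
  have hc_zero : ∀ i, hH.eigenvalues i < e₀ → c i = 0 := by
    intro i hi
    rw [hc_eq, projMatrix_map_mulVec_eigenvector_below_eq_zero hH K hinv (hcol i) hi]
    simp
  have hc_sum : ∑ i, c i = (Module.finrank ℂ K : ℂ) := by
    have h1 : ∑ i, c i = (star U * P * U).trace := rfl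
    rw [h1, trace_mul_cycle, Unitary.mul_star_self_of_mem hUm, Matrix.one_mul, hP,
      trace_projMatrix_map_eq_finrank]
  have htr : (P * gibbsWeight β H).trace =
      ∑ i, (Real.exp (-β * hH.eigenvalues i) : ℂ) * c i := by
    rw [trace_mul_comm, trace_gibbsWeight_mul_eq_sum hH β P]
  rw [htr, Complex.re_sum]
  have hterm : ∀ i, ((Real.exp (-β * hH.eigenvalues i) : ℂ) * c i).re ≤
      Real.exp (-(β * e₀)) * (c i).re := by
    intro i
    rw [Complex.re_ofReal_mul]
    by_cases hi : hH.eigenvalues i < e₀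
    · rw [hc_zero i hi]
      simp
    · refine mul_le_mul_of_nonneg_right (Real.exp_le_exp.mpr ?_) (hc_re i)
      nlinarith [not_lt.mp hi]
  refine (Finset.sum_le_sum fun i _ => hterm i).trans (le_of_eq ?_)
  rw [← Finset.mul_sum, ← Complex.re_sum, hc_sum, mul_comm]
  norm_cast

/-- **EVERY SECTOR GROUND STATE FROM A THERMAL κ-CHORD (abstract form).** `H`, `A` Hermitian,
`K` an `H`-invariant subspace with orthogonal projection `P_K`, `ψ ∈ K` a normalised sector
ground state (`H ψ = e₀ ψ`, `e₀ = minEnergyOn H K`), `κ, β > 0`. Then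
`(log re tr (P_K e^{-βH}) - log re tr (P_K e^{-β(H + κA)}) - log dim K) / (β κ) ≤ re ⟨ψ, A ψ⟩`.
Proof: `re tr (P_K e^{-β(H+κA)}) ≥ re ⟨ψ, e^{-β(H+κA)} ψ⟩ ≥ e^{-β(e₀ + κ re ⟨ψ,Aψ⟩)}`
(`re_rayleigh_le_re_trace_projMatrix_mul`, `exp_neg_mul_rayleigh_le_re_gibbsWeight`) and
`re tr (P_K e^{-βH}) ≤ dim K · e^{-βe₀}` (`re_trace_sectorProj_mul_gibbsWeight_le`); take logs.
The one-vector Peierls–Bogoliubov inequality with an entropy budget: B. Simon, *Statistical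
Mechanics of Lattice Gases* I §II.13; Bratteli–Robinson II §5.3.1. [folklore] -/
theorem thermalChord_le_re_rayleigh {H A : Matrix n n ℂ} (hH : H.IsHermitian)
    (hA : A.IsHermitian) (K : Submodule ℂ (n → ℂ)) (hinv : ∀ v ∈ K, H *ᵥ v ∈ K) {ψ : n → ℂ}
    (hψK : ψ ∈ K) (hψ : star ψ ⬝ᵥ ψ = 1) (hHψ : H *ᵥ ψ = ((H.minEnergyOn K : ℝ) : ℂ) • ψ)
    {κ β : ℝ} (hκ : 0 < κ) (hβ : 0 < β) :
    (Real.log (projMatrix (K.map ((WithLp.linearEquiv 2 ℂ (n → ℂ)).symm :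
          (n → ℂ) →ₗ[ℂ] EuclideanSpace ℂ n)) * gibbsWeight β H).trace.re -
        Real.log (projMatrix (K.map ((WithLp.linearEquiv 2 ℂ (n → ℂ)).symm :
          (n → ℂ) →ₗ[ℂ] EuclideanSpace ℂ n)) * gibbsWeight β (H + (κ : ℂ) • A)).trace.re -
        Real.log (Module.finrank ℂ K)) / (β * κ) ≤ (star ψ ⬝ᵥ A *ᵥ ψ).re := by
  set P := projMatrix (K.map ((WithLp.linearEquiv 2 ℂ (n → ℂ)).symm :
    (n → ℂ) →ₗ[ℂ] EuclideanSpace ℂ n)) with hP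
  set e₀ : ℝ := H.minEnergyOn K with he₀
  set a : ℝ := (star ψ ⬝ᵥ A *ᵥ ψ).re with ha
  set d : ℕ := Module.finrank ℂ K with hd
  have hXh : (H + (κ : ℂ) • A).IsHermitian :=
    hH.add (hA.smul (by rw [isSelfAdjoint_iff, Complex.star_def, Complex.conj_ofReal]))
  -- Rayleigh quotients of the ground state
  have hRH : (star ψ ⬝ᵥ H *ᵥ ψ).re = e₀ := by
    rw [hHψ, dotProduct_smul, hψ, smul_eq_mul, mul_one, Complex.ofReal_re]
  have hRX : (star ψ ⬝ᵥ (H + (κ : ℂ) • A) *ᵥ ψ).re = e₀ + κ * a := by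
    rw [add_mulVec, dotProduct_add, Complex.add_re, hRH, smul_mulVec, dotProduct_smul,
      smul_eq_mul, Complex.re_ofReal_mul]
  -- lower bound on `Z_K(β, H + κA)` and on `Z_K(β, H)`
  have hZ1 : Real.exp (-(β * (e₀ + κ * a))) ≤ (P * gibbsWeight β (H + (κ : ℂ) • A)).trace.re := by
    rw [← hRX]
    exact (exp_neg_mul_rayleigh_le_re_gibbsWeight hXh β hψ).trans
      (re_rayleigh_le_re_trace_projMatrix_mul (posDef_gibbsWeight β hXh).posSemidef K hψK hψ)
  have hZ0 : Real.exp (-(β * e₀)) ≤ (P * gibbsWeight β H).trace.re := by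
    rw [← hRH]
    exact (exp_neg_mul_rayleigh_le_re_gibbsWeight hH β hψ).trans
      (re_rayleigh_le_re_trace_projMatrix_mul (posDef_gibbsWeight β hH).posSemidef K hψK hψ)
  -- the entropy budget
  have hZ0' : (P * gibbsWeight β H).trace.re ≤ (d : ℝ) * Real.exp (-(β * e₀)) :=
    re_trace_sectorProj_mul_gibbsWeight_le hH K hinv hβ.le
  -- `dim K ≥ 1`
  have hψ0 : ψ ≠ 0 := by
    rintro rfl
    simp at hψ
  have hd1 : (1 : ℝ) ≤ d := by
    have : 0 < d := Module.finrank_pos_iff_exists_ne_zero.mpr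
      ⟨⟨ψ, hψK⟩, fun h => hψ0 (by simpa using congrArg Subtype.val h)⟩
    exact_mod_cast this
  -- logarithms
  have hl1 : -(β * (e₀ + κ * a)) ≤ Real.log (P * gibbsWeight β (H + (κ : ℂ) • A)).trace.re := by
    rw [← Real.log_exp (-(β * (e₀ + κ * a)))]
    exact Real.log_le_log (Real.exp_pos _) hZ1
  have hl0 : Real.log (P * gibbsWeight β H).trace.re ≤ Real.log d + -(β * e₀) := by
    rw [← Real.log_exp (-(β * e₀)), ← Real.log_mul (by positivity) (Real.exp_pos _).ne']
    exact Real.log_le_log ((Real.exp_pos _).trans_le hZ0) hZ0'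
  rw [div_le_iff₀ (by positivity)]
  nlinarith [hl0, hl1, hκ, hβ]

/-- **Registered form** (sub-goal `sectorThermalChordBound` of item `stmt-HubbardSuperconductivity-2083`):
`thermalChord_le_re_rayleigh` as a closed proposition over `n : Type`. [folklore] -/
theorem sectorThermalChordBound : ∀ {n : Type} [Fintype n] [DecidableEq n] (H A : Matrix n n ℂ), H.IsHermitian → A.IsHermitian → ∀ (K : Submodule ℂ (n → ℂ)), (∀ v ∈ K, H *ᵥ v ∈ K) → ∀ (ψ : n → ℂ), ψ ∈ K → star ψ ⬝ᵥ ψ = 1 → H *ᵥ ψ = ((H.minEnergyOn K : ℝ) : ℂ) • ψ → ∀ (κ β : ℝ), 0 < κ → 0 < β → (Real.log (Literature.MathematicalPhysics.QuantumLattice.projMatrix (K.map ((WithLp.linearEquiv 2 ℂ (n → ℂ)).symm : (n → ℂ) →ₗ[ℂ] EuclideanSpace ℂ n)) * Matrix.gibbsWeight β H).trace.re - Real.log (Literature.MathematicalPhysics.QuantumLattice.projMatrix (K.map ((WithLp.linearEquiv 2 ℂ (n → ℂ)).symm : (n → ℂ) →ₗ[ℂ] EuclideanSpace ℂ n)) *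 Matrix.gibbsWeight β (H + (κ : ℂ) • A)).trace.re - Real.log (Module.finrank ℂ K)) / (β * κ) ≤ (star ψ ⬝ᵥ A *ᵥ ψ).re :=
  fun _ _ hH hA K hinv _ hψK hψ hHψ _ _ hκ hβ =>
    thermalChord_le_re_rayleigh hH hA K hinv hψK hψ hHψ hκ hβ

end Abstract

end Summit.HubbardSuperconductivity.HubbardSuperconductivity.Theorems
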